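import Summits.QuantumFields.YangMills.Theorems.SwapVirialDeficitSwapGluedStiffnessOfVirialWindow
import Summits.QuantumFields.YangMills.Theorems.SwapVirialDeficitSwapRingSectorPairing
import Summits.QuantumFields.YangMills.Theorems.SwapVirialDeficitOddSectorExplicitGap
import Summits.QuantumFields.YangMills.Theorems.LuscherReductionRunningReductionTraceFormulaAveraging
import HarnessLib

/-!
# The VIRIAL-WINDOW INEQUALITY (VW) from its PRINCIPAL-SECTOR row and the minus-class smallness — six of the eight seam sectors discharged
# (file D3 of the V2′ assembly; free-hands support of ⟨stmt-QuantumFields-24197⟩ `SwapVirialDeficit.SwapGluedStiffness`)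

✓`swapGluedStiffness_of_virialWindow` (D2) reduces the crux to (VW): `K_L·Σ_z T̂_z ≤ (1/2 − c)·Σ_z Z_z` on a window, with the VIRIAL TERM of sector `z`
`K_L·T̂_z := K_L·(½⟪W⟫_{z,β} − β⟪R⟫_{z,β}) = (9L⁴−1)·Z_z(β) − β·E_z(β)` (✓`virial_ring'`).  The eight seam sectors `z : Fin 3 → Bool` fall in three classes:
ODD (`z 0 ≠ z 1`, four sectors — VOID below `u_L = (1248L³)^{−2}` uniformly in `L`, ✓`OddSectorGap.swap_oddSector_void_uniform`), the PRINCIPAL pair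
`{000, 110}` and the MINUS pair `{001, 111}` (paired by the slice flip `z ↦ z + (1,1,0)`, ✓`SwapRing.integral_comp_swapDeficit_sliceFlip`).  Hence:
* §1 `virialTerm_eq` (`K_L T̂_z = (9L⁴−1)Z_z − βE_z`), `virialTerm_le` (`≤ (9L⁴−1)Z_z`), `oddSector_meanDeficit_ge` (`E_z ≥ ½u_L·Z_z` for odd `z`),
  ★ `oddSector_virialTerm_nonpos` (`K_L T̂_z ≤ 0` for odd `z` once `18·1248²·L^{10} ≤ β`), pairing `laplace_sliceFlip` ∕ `meanDeficit_sliceFlip` ∕ `virialTerm_sliceFlip`,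
  the class lemmas `eq_of_principalPair` ∕ `eq_of_minusPair`, and the window arithmetic `pow_ten_le_of_window`;
* §2 ★★★ `virialWindow_of_principal_and_minus` — (VW) FOLLOWS from
  (P-VW) the principal-sector virial window `K_L·(½⟪W⟫_{000,β} − β⟪R⟫_{000,β}) ≤ (1/2 − c)·Z_{000}(β)` on a window, and
  (M) the minus-class relative smallness `∀ ε > 0`, on a window `L⁴·Z_{001}(β) ≤ ε·Z_{000}(β)`;
  ★★★ `swapGluedStiffness_of_principalVirialWindow_and_minus` — hence the crux BY NAME from (P-VW) + (M) (✓D2).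
(P-VW) in turn = [followers' share, FREE: w2 g57's ✓/⧗`followersW_term_apriori`, `O(L^{14} log β/β)·Z_{000}`] + [THE VALLEY TERM of the three leader letters:
the window-uniform two-scale estimate of a fixed finite-dimensional integral with `poly(L)` stiffness constants — OPEN]; (M) is the uniform version of the fixed-`L`
✓`tendsto_rpow_mul_nonprincipal_laplace` — OPEN (same (M) as in ✓`…SwapGluedStiffnessOfPrincipalAndMinus`).
HONEST LABEL: a CONDITIONAL reduction (odd sectors and pairings discharged unconditionally); (P-VW), (M), ⟨24197⟩ ∕ ⟨24194⟩ ∕ ⟨24196⟩ ∕ ⟨24497⟩ OPEN; the Yang–Mills mass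
gap is NOT proved; no summit is proved by a line.  Seat ym-line-fcl-p3 g46 (cell ym-idea-1, free hands; item of record ⟨24085⟩ aside, untouched), `--supports stmt-QuantumFields-24197`.
THEOREMS ONLY (hypotheses inline), 0 `sorry`, standard axioms; the series' local `ℍ` instances.  References: [cite: tHooft1979]; [cite: Luscher1983, §2]; [folklore].
-/

set_option autoImplicit false
set_option synthInstance.maxSize 1024

noncomputable section

open MeasureTheory Quaternion Set Filter Topology
open scoped Quaternion BigOperators
open Literature.MathematicalPhysics.QuantumLattice
open Literature.MathematicalPhysics.QuantumFieldTheory hiding SU2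
open Summit.QuantumFields.YangMills.Theorems.FemtoTransferGap
open Summit.QuantumFields.YangMills.Theorems.FemtoTransferGap.TT
open Summit.QuantumFields.YangMills.Theorems.VirialFluxGap.RingDeficit
open Summit.QuantumFields.YangMills.Theorems.SwapTwistDeficit.ToronLog (coneMeasure coneConst isProbabilityMeasure_coneMeasure)
open Summit.QuantumFields.YangMills.Theorems.SwapVirialDeficit.SwapRing
open Summit.QuantumFields.YangMills.Theorems.SwapVirialDeficit.OddSectorGap (swap_oddSector_void_uniform)

attribute [local instance] Literature.Analysis.FluidPDE.Tao2016.quatMeasurableSpace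
  Literature.Analysis.FluidPDE.Tao2016.quatBorelSpace
  Literature.MathematicalPhysics.QuantumLattice.secondCountableTopology_su2

namespace Summit.QuantumFields.YangMills.Theorems.SwapVirialDeficit.BlowUpRing

variable {L : ℕ} [NeZero L]

/-! ## §1 The virial term of a sector, the odd sectors, the pairing -/

/-- ★ **The virial term of sector `z` equals `(9L⁴−1)·Z_z − β·E_z`** (✓`virial_ring'`, ✓`half_two_alpha_eq`). [folklore] -/
theorem virialTerm_eq (z : Fin 3 → Bool) {β : ℝ} (hβ : 0 < β) :
    (coneConst ^ 3 / 64 * (1 / (2 * Real.pi ^ 2)) ^ Fintype.card (Fol L)) *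
        (1 / 2 * (∫ a, (∑ ε : GnoSign L, ∫ η : GnoCoord L,
            gnoW η * Real.exp (-(β * gnoDeficit z (fun _ => 1) a ε η)) * gnoDensity η) ∂coneMeasure)
          - β * (∫ a, (∑ ε : GnoSign L, ∫ η : GnoCoord L,
            (gnoDeficit z (fun _ => 1) a ε η - gnoXDeficit z (fun _ => 1) a ε η / 2) *
              Real.exp (-(β * gnoDeficit z (fun _ => 1) a ε η)) * gnoDensity η) ∂coneMeasure)) =
      (9 * (L : ℝ) ^ 4 - 1) * (∫ p, Real.exp (-(β * swapRingDeficit L z p)) ∂(ringMeasure L))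
        - β * ∫ p, swapRingDeficit L z p * Real.exp (-(β * swapRingDeficit L z p)) ∂(ringMeasure L) := by
  have h := virial_ring' (L := L) z hβ
  rw [half_two_alpha_eq] at h
  linarith

/-- `E_z(β) ≥ 0`. [folklore] -/
theorem meanDeficit_nonneg (z : Fin 3 → Bool) (β : ℝ) :
    0 ≤ ∫ p, swapRingDeficit L z p * Real.exp (-(β * swapRingDeficit L z p)) ∂(ringMeasure L) :=
  integral_nonneg fun p => mul_nonneg (swapRingDeficit_nonneg z p) (Real.exp_pos _).le

/-- The virial term of any sector is at most `(9L⁴−1)·Z_z` (`β > 0`). [folklore] -/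
theorem virialTerm_le (z : Fin 3 → Bool) {β : ℝ} (hβ : 0 < β) :
    (coneConst ^ 3 / 64 * (1 / (2 * Real.pi ^ 2)) ^ Fintype.card (Fol L)) *
        (1 / 2 * (∫ a, (∑ ε : GnoSign L, ∫ η : GnoCoord L,
            gnoW η * Real.exp (-(β * gnoDeficit z (fun _ => 1) a ε η)) * gnoDensity η) ∂coneMeasure)
          - β * (∫ a, (∑ ε : GnoSign L, ∫ η : GnoCoord L,
            (gnoDeficit z (fun _ => 1) a ε η - gnoXDeficit z (fun _ => 1) a ε η / 2) *
              Real.exp (-(β * gnoDeficit z (fun _ => 1) a ε η)) * gnoDensity η) ∂coneMeasure)) ≤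
      (9 * (L : ℝ) ^ 4 - 1) * ∫ p, Real.exp (-(β * swapRingDeficit L z p)) ∂(ringMeasure L) := by
  rw [virialTerm_eq z hβ]
  have h := meanDeficit_nonneg (L := L) z β
  nlinarith

/-- ★ **Odd sectors have mean deficit at least `½u_L`**: for `z 0 ≠ z 1`, `E_z(β) ≥ ½(1248L³)^{−2}·Z_z(β)` (the sector is void below `u_L`,
✓`swap_oddSector_void_uniform`, uniformly in `L`). [cite: Luscher1983, §2] -/
theorem oddSector_meanDeficit_ge (z : Fin 3 → Bool) (hz : z 0 ≠ z 1) (β : ℝ) :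
    ((1248 * (L : ℝ) ^ 3) ^ 2)⁻¹ / 2 * ∫ p, Real.exp (-(β * swapRingDeficit L z p)) ∂(ringMeasure L) ≤
      ∫ p, swapRingDeficit L z p * Real.exp (-(β * swapRingDeficit L z p)) ∂(ringMeasure L) := by
  haveI : IsProbabilityMeasure (ringMeasure L) := isProbabilityMeasure_ringMeasure (L := L)
  set u : ℝ := ((1248 * (L : ℝ) ^ 3) ^ 2)⁻¹ / 2 with hu
  have hL : (0 : ℝ) < (L : ℝ) := Nat.cast_pos.2 (NeZero.pos L)
  have hupos : 0 < ((1248 * (L : ℝ) ^ 3) ^ 2)⁻¹ := by positivity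
  have hult : u < ((1248 * (L : ℝ) ^ 3) ^ 2)⁻¹ := by rw [hu]; linarith
  have hvoid := swap_oddSector_void_uniform (L := L) z hz hult
  have hnull : (ringMeasure L) {P | swapRingDeficit L z P ≤ u} = 0 := by
    rwa [measureReal_def, ENNReal.toReal_eq_zero_iff, or_iff_left (measure_ne_top _ _)] at hvoid
  have hae : ∀ᵐ P ∂(ringMeasure L), u < swapRingDeficit L z P := by
    rw [ae_iff]
    simpa only [not_lt] using hnull
  rw [← integral_const_mul]
  refine integral_mono_ae ((integrable_exp_swapDeficit z β).const_mul u) (integrable_swapDeficit_mul_exp z β) ?_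
  filter_upwards [hae] with P hP
  exact mul_le_mul_of_nonneg_right hP.le (Real.exp_pos _).le

/-- ★ **The odd sectors' virial terms are non-positive** once `18·1248²·L^{10} ≤ β` (then `β·½u_L ≥ 9L⁴ ≥ 9L⁴ − 1`). [folklore] -/
theorem oddSector_virialTerm_nonpos (z : Fin 3 → Bool) (hz : z 0 ≠ z 1) {β : ℝ} (hβ : 0 < β) (hβL : 18 * 1248 ^ 2 * (L : ℝ) ^ 10 ≤ β) :
    (coneConst ^ 3 / 64 * (1 / (2 * Real.pi ^ 2)) ^ Fintype.card (Fol L)) *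
        (1 / 2 * (∫ a, (∑ ε : GnoSign L, ∫ η : GnoCoord L,
            gnoW η * Real.exp (-(β * gnoDeficit z (fun _ => 1) a ε η)) * gnoDensity η) ∂coneMeasure)
          - β * (∫ a, (∑ ε : GnoSign L, ∫ η : GnoCoord L,
            (gnoDeficit z (fun _ => 1) a ε η - gnoXDeficit z (fun _ => 1) a ε η / 2) *
              Real.exp (-(β * gnoDeficit z (fun _ => 1) a ε η)) * gnoDensity η) ∂coneMeasure)) ≤ 0 := by
  rw [virialTerm_eq z hβ]
  set Z : ℝ := ∫ p, Real.exp (-(β * swapRingDeficit L z p)) ∂(ringMeasure L) with hZ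
  have hZ0 : 0 ≤ Z := integral_nonneg fun p => (Real.exp_pos _).le
  have hE := oddSector_meanDeficit_ge (L := L) z hz β
  have hL : (0 : ℝ) < (L : ℝ) := Nat.cast_pos.2 (NeZero.pos L)
  have hL6 : (0 : ℝ) < (1248 * (L : ℝ) ^ 3) ^ 2 := by positivity
  -- `β · ½u_L ≥ 9L⁴`
  have hkey : 9 * (L : ℝ) ^ 4 ≤ β * (((1248 * (L : ℝ) ^ 3) ^ 2)⁻¹ / 2) := by
    rw [show β * (((1248 * (L : ℝ) ^ 3) ^ 2)⁻¹ / 2) = β / (2 * (1248 * (L : ℝ) ^ 3) ^ 2) by field_simp, le_div_iff₀ (by positivity)]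
    nlinarith
  have h1 : β * (((1248 * (L : ℝ) ^ 3) ^ 2)⁻¹ / 2 * Z) ≤ β * ∫ p, swapRingDeficit L z p * Real.exp (-(β * swapRingDeficit L z p)) ∂(ringMeasure L) :=
    mul_le_mul_of_nonneg_left hE hβ.le
  nlinarith

/-- Pairing of the Laplace integrals: `Z_{z+(1,1,0)} = Z_z`. [cite: tHooft1979] -/
theorem laplace_sliceFlip (z : Fin 3 → Bool) (β : ℝ) :
    ∫ p, Real.exp (-(β * swapRingDeficit L (fun k => Bool.xor (z k) (decide (k ≠ 2))) p)) ∂(ringMeasure L) =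
      ∫ p, Real.exp (-(β * swapRingDeficit L z p)) ∂(ringMeasure L) :=
  integral_exp_swapDeficit_sliceFlip z β

/-- Pairing of the mean deficits: `E_{z+(1,1,0)} = E_z`. [cite: tHooft1979] -/
theorem meanDeficit_sliceFlip (z : Fin 3 → Bool) (β : ℝ) :
    ∫ p, swapRingDeficit L (fun k => Bool.xor (z k) (decide (k ≠ 2))) p *
        Real.exp (-(β * swapRingDeficit L (fun k => Bool.xor (z k) (decide (k ≠ 2))) p)) ∂(ringMeasure L) =
      ∫ p, swapRingDeficit L z p * Real.exp (-(β * swapRingDeficit L z p)) ∂(ringMeasure L) :=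
  integral_comp_swapDeficit_sliceFlip z (fun x => x * Real.exp (-(β * x)))
    (measurable_id.mul (Real.measurable_exp.comp (measurable_const.mul measurable_id).neg))

/-- A sector with `z 0 = z 1`, `z 2 = false` is `000` or `110`. [folklore] -/
theorem eq_of_principalPair (z : Fin 3 → Bool) (h01 : z 0 = z 1) (h2 : z 2 = false) :
    z = (fun _ => false) ∨ z = (fun k : Fin 3 => Bool.xor ((fun _ : Fin 3 => false) k) (decide (k ≠ 2))) := by
  cases h0 : z 0
  · left; funext k; fin_cases k
    · exact h0
    · show z 1 = false; rw [← h01, h0]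
    · exact h2
  · right; funext k; fin_cases k
    · simpa using h0
    · show z 1 = _; rw [← h01, h0]; decide
    · show z 2 = _; rw [h2]; decide

/-- A sector with `z 0 = z 1`, `z 2 = true` is `001` or `111`. [folklore] -/
theorem eq_of_minusPair (z : Fin 3 → Bool) (h01 : z 0 = z 1) (h2 : z 2 = true) :
    z = (fun k : Fin 3 => decide (k = 2)) ∨ z = (fun k : Fin 3 => Bool.xor ((fun k : Fin 3 => decide (k = 2)) k) (decide (k ≠ 2))) := by
  cases h0 : z 0
  · left; funext k; fin_cases k
    · simpa using h0
    · show z 1 = _; rw [← h01, h0]; decide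
    · show z 2 = _; rw [h2]; decide
  · right; funext k; fin_cases k
    · simpa using h0
    · show z 1 = _; rw [← h01, h0]; decide
    · show z 2 = _; rw [h2]; decide

omit [NeZero L] in
/-- Window arithmetic: `1 ≤ β`, `a ≤ 1/20`, `L ≤ β^a` give `L^{10} ≤ β^{1/2}` and hence `18·1248²·L^{10} ≤ β` once `(18·1248²)² ≤ β`. [folklore] -/
theorem odd_threshold_of_window {a β : ℝ} (ha : a ≤ 1 / 20) (hβ1 : 1 ≤ β) (hβB : (18 * 1248 ^ 2 : ℝ) ^ 2 ≤ β) (hLβ : (L : ℝ) ≤ β ^ a) :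
    18 * 1248 ^ 2 * (L : ℝ) ^ 10 ≤ β := by
  have hβ0 : 0 ≤ β := le_trans zero_le_one hβ1
  have hL0 : (0 : ℝ) ≤ (L : ℝ) := Nat.cast_nonneg L
  have h1 : (L : ℝ) ≤ β ^ (1 / 20 : ℝ) := hLβ.trans (Real.rpow_le_rpow_of_exponent_le hβ1 ha)
  have h2 : (L : ℝ) ^ 10 ≤ β ^ (1 / 2 : ℝ) := by
    calc (L : ℝ) ^ 10 ≤ (β ^ (1 / 20 : ℝ)) ^ 10 := pow_le_pow_left₀ hL0 h1 10
      _ = β ^ (1 / 2 : ℝ) := by rw [← Real.rpow_natCast, ← Real.rpow_mul hβ0]; norm_num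
  have h3 : (18 * 1248 ^ 2 : ℝ) ≤ β ^ (1 / 2 : ℝ) := by
    have : ((18 * 1248 ^ 2 : ℝ) ^ 2) ^ (1 / 2 : ℝ) ≤ β ^ (1 / 2 : ℝ) := Real.rpow_le_rpow (by positivity) hβB (by norm_num)
    rwa [← Real.rpow_natCast, ← Real.rpow_mul (by positivity), show ((2 : ℕ) : ℝ) * (1 / 2 : ℝ) = 1 by norm_num, Real.rpow_one] at this
  calc 18 * 1248 ^ 2 * (L : ℝ) ^ 10 ≤ β ^ (1 / 2 : ℝ) * β ^ (1 / 2 : ℝ) := mul_le_mul h3 h2 (by positivity) (by positivity)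
    _ = β := by rw [← Real.rpow_add (lt_of_lt_of_le one_pos hβ1)]; norm_num

/-! ## §2 (VW) from the principal-sector virial window and the minus-class smallness -/

/-- ★★★ **THE VIRIAL-WINDOW INEQUALITY FROM ITS PRINCIPAL ROW AND THE MINUS-CLASS SMALLNESS.**  Hypotheses (both OPEN, window-uniform):
(P-VW) `∃ a > 0, c > 0, β₀, L₀`: on the window `K_L·(½⟪W⟫_{000,β} − β⟪R⟫_{000,β}) ≤ (1/2 − c)·Z_{000}(β)` (principal sector, principal character);
(M) `∀ ε > 0, ∃ a > 0, β₀, L₀`: on the window `L⁴·Z_{001}(β) ≤ ε·Z_{000}(β)` (minus class relatively small).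
Conclusion: (VW) of ✓`swapGluedStiffness_of_virialWindow` with `c/2 ∧ 1/4`-type margin (`min c (1/2) / 2`).  The four ODD sectors are discharged by
✓`oddSector_virialTerm_nonpos` (void below `(1248L³)^{−2}`, uniform in `L`), the partners `110`, `111` by the slice-flip pairing. [cite: tHooft1979] [cite: Luscher1983, §2] -/
theorem virialWindow_of_principal_and_minus
    (hP : ∃ a : ℝ, 0 < a ∧ ∃ c : ℝ, 0 < c ∧ ∃ β₀ : ℝ, ∃ L₀ : ℕ, ∀ β : ℝ, β₀ ≤ β → ∀ (L : ℕ) [NeZero L], L₀ ≤ L → (L : ℝ) ≤ β ^ a →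
      (coneConst ^ 3 / 64 * (1 / (2 * Real.pi ^ 2)) ^ Fintype.card (Fol L)) *
          (1 / 2 * (∫ a, (∑ ε : GnoSign L, ∫ η : GnoCoord L,
              gnoW η * Real.exp (-(β * gnoDeficit (fun _ => false) (fun _ => 1) a ε η)) * gnoDensity η) ∂coneMeasure)
            - β * (∫ a, (∑ ε : GnoSign L, ∫ η : GnoCoord L,
              (gnoDeficit (fun _ => false) (fun _ => 1) a ε η - gnoXDeficit (fun _ => false) (fun _ => 1) a ε η / 2) *
                Real.exp (-(β * gnoDeficit (fun _ => false) (fun _ => 1) a ε η)) * gnoDensity η) ∂coneMeasure)) ≤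
        (1 / 2 - c) * ∫ p, Real.exp (-(β * swapRingDeficit L (fun _ => false) p)) ∂(ringMeasure L))
    (hM : ∀ ε : ℝ, 0 < ε → ∃ a : ℝ, 0 < a ∧ ∃ β₀ : ℝ, ∃ L₀ : ℕ, ∀ β : ℝ, β₀ ≤ β → ∀ (L : ℕ) [NeZero L], L₀ ≤ L → (L : ℝ) ≤ β ^ a →
      (L : ℝ) ^ 4 * ∫ p, Real.exp (-(β * swapRingDeficit L (fun k => decide (k = 2)) p)) ∂(ringMeasure L) ≤
        ε * ∫ p, Real.exp (-(β * swapRingDeficit L (fun _ => false) p)) ∂(ringMeasure L)) :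
    ∃ a : ℝ, 0 < a ∧ ∃ c : ℝ, 0 < c ∧ ∃ β₀ : ℝ, ∃ L₀ : ℕ, ∀ β : ℝ, β₀ ≤ β → ∀ (L : ℕ) [NeZero L], L₀ ≤ L → (L : ℝ) ≤ β ^ a →
      (coneConst ^ 3 / 64 * (1 / (2 * Real.pi ^ 2)) ^ Fintype.card (Fol L)) *
          ∑ z : Fin 3 → Bool,
            (1 / 2 * (∫ a, (∑ ε : GnoSign L, ∫ η : GnoCoord L,
                gnoW η * Real.exp (-(β * gnoDeficit z (fun _ => 1) a ε η)) * gnoDensity η) ∂coneMeasure)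
              - β * (∫ a, (∑ ε : GnoSign L, ∫ η : GnoCoord L,
                (gnoDeficit z (fun _ => 1) a ε η - gnoXDeficit z (fun _ => 1) a ε η / 2) *
                  Real.exp (-(β * gnoDeficit z (fun _ => 1) a ε η)) * gnoDensity η) ∂coneMeasure)) ≤
        (1 / 2 - c) * ∑ z : Fin 3 → Bool, ∫ p, Real.exp (-(β * swapRingDeficit L z p)) ∂(ringMeasure L) := by
  obtain ⟨a₁, ha₁, c, hc, β₁, L₁, hPW⟩ := hP
  -- cap the margin at `1/2`
  set c₁ : ℝ := min c (1 / 2) with hc₁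
  have hc₁pos : 0 < c₁ := lt_min hc (by norm_num)
  have hc₁le : c₁ ≤ c := min_le_left _ _
  have hc₁half : c₁ ≤ 1 / 2 := min_le_right _ _
  obtain ⟨a₂, ha₂, β₂, L₂, hMW⟩ := hM (c₁ / 144) (by positivity)
  refine ⟨min a₁ (min a₂ (1 / 20)), lt_min ha₁ (lt_min ha₂ (by norm_num)), c₁ / 2, by positivity,
    max (max β₁ β₂) (max 1 ((18 * 1248 ^ 2 : ℝ) ^ 2)), max L₁ L₂, fun β hβ L _ hL hLβ => ?_⟩
  -- the window implies every sub-window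
  have hβ₁ : β₁ ≤ β := le_trans (le_trans (le_max_left _ _) (le_max_left _ _)) hβ
  have hβ₂ : β₂ ≤ β := le_trans (le_trans (le_max_right _ _) (le_max_left _ _)) hβ
  have hβ1 : (1 : ℝ) ≤ β := le_trans (le_trans (le_max_left _ _) (le_max_right _ _)) hβ
  have hβB : (18 * 1248 ^ 2 : ℝ) ^ 2 ≤ β := le_trans (le_trans (le_max_right _ _) (le_max_right _ _)) hβ
  have hβpos : 0 < β := lt_of_lt_of_le one_pos hβ1
  have hL₁ : L₁ ≤ L := le_trans (le_max_left _ _) hL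
  have hL₂ : L₂ ≤ L := le_trans (le_max_right _ _) hL
  have hLa₁ : (L : ℝ) ≤ β ^ a₁ := hLβ.trans (Real.rpow_le_rpow_of_exponent_le hβ1 (min_le_left _ _))
  have hLa₂ : (L : ℝ) ≤ β ^ a₂ := hLβ.trans (Real.rpow_le_rpow_of_exponent_le hβ1 ((min_le_right _ _).trans (min_le_left _ _)))
  have hL20 : (L : ℝ) ≤ β ^ (1 / 20 : ℝ) := hLβ.trans (Real.rpow_le_rpow_of_exponent_le hβ1 ((min_le_right _ _).trans (min_le_right _ _)))
  have hodd : 18 * 1248 ^ 2 * (L : ℝ) ^ 10 ≤ β := odd_threshold_of_window (L := L) le_rfl hβ1 hβB hL20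
  -- abbreviations
  set K : ℝ := coneConst ^ 3 / 64 * (1 / (2 * Real.pi ^ 2)) ^ Fintype.card (Fol L) with hK
  set Z : (Fin 3 → Bool) → ℝ := fun z => ∫ p, Real.exp (-(β * swapRingDeficit L z p)) ∂(ringMeasure L) with hZ
  set T : (Fin 3 → Bool) → ℝ := fun z => K *
      (1 / 2 * (∫ a, (∑ ε : GnoSign L, ∫ η : GnoCoord L,
          gnoW η * Real.exp (-(β * gnoDeficit z (fun _ => 1) a ε η)) * gnoDensity η) ∂coneMeasure)
        - β * (∫ a, (∑ ε : GnoSign L, ∫ η : GnoCoord L,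
          (gnoDeficit z (fun _ => 1) a ε η - gnoXDeficit z (fun _ => 1) a ε η / 2) *
            Real.exp (-(β * gnoDeficit z (fun _ => 1) a ε η)) * gnoDensity η) ∂coneMeasure)) with hT
  have hZ0 : ∀ z, 0 ≤ Z z := fun z => integral_nonneg fun p => (Real.exp_pos _).le
  have hTeq : ∀ z, T z = (9 * (L : ℝ) ^ 4 - 1) * Z z - β * ∫ p, swapRingDeficit L z p * Real.exp (-(β * swapRingDeficit L z p)) ∂(ringMeasure L) :=
    fun z => virialTerm_eq z hβpos
  have hTle : ∀ z, T z ≤ 9 * (L : ℝ) ^ 4 * Z z := fun z => by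
    have h1 : T z ≤ (9 * (L : ℝ) ^ 4 - 1) * Z z := virialTerm_le z hβpos
    have h2 := hZ0 z
    nlinarith
  -- the two hypotheses on this window
  have hPβ : T (fun _ => false) ≤ (1 / 2 - c₁) * Z (fun _ => false) := by
    have h := hPW β hβ₁ L hL₁ hLa₁
    have h2 := hZ0 (fun _ => false)
    have h3 : (1 / 2 - c) * Z (fun _ => false) ≤ (1 / 2 - c₁) * Z (fun _ => false) := by nlinarith
    exact h.trans h3
  have hMβ : (L : ℝ) ^ 4 * Z (fun k => decide (k = 2)) ≤ c₁ / 144 * Z (fun _ => false) := hMW β hβ₂ L hL₂ hLa₂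
  -- pairing
  have hZflip : ∀ z, Z (fun k => Bool.xor (z k) (decide (k ≠ 2))) = Z z := fun z => laplace_sliceFlip z β
  have hTflip : ∀ z, T (fun k => Bool.xor (z k) (decide (k ≠ 2))) = T z := fun z => by
    rw [hTeq, hTeq, hZflip, meanDeficit_sliceFlip]
  -- the termwise majorant
  set g : (Fin 3 → Bool) → ℝ := fun z =>
    (if z 0 = z 1 ∧ z 2 = false then (1 / 2 - c₁) * Z z else 0) + (if z 0 = z 1 ∧ z 2 = true then 9 * (L : ℝ) ^ 4 * Z (fun k => decide (k = 2)) else 0)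
    with hg
  have claim : ∀ z, T z ≤ g z := by
    intro z
    by_cases h01 : z 0 = z 1
    · by_cases h2 : z 2 = true
      · -- minus pair
        have hg' : g z = 9 * (L : ℝ) ^ 4 * Z (fun k => decide (k = 2)) := by
          simp only [hg, h01, h2, and_true, true_and, if_true]; simp
        rw [hg']
        rcases eq_of_minusPair z h01 h2 with h | h
        · rw [h]; exact hTle _
        · rw [h, hTflip]; exact hTle _
      · -- principal pair
        have h2' : z 2 = false := by simpa using h2
        have hg' : g z = (1 / 2 - c₁) * Z z := by
          simp only [hg, h01, h2', and_true, true_and, if_true]; simp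
        rw [hg']
        rcases eq_of_principalPair z h01 h2' with h | h
        · rw [h]; exact hPβ
        · rw [h, hTflip, hZflip]; exact hPβ
    · -- odd sector
      have hg' : g z = 0 := by simp only [hg, h01, false_and, if_false, add_zero]
      rw [hg']
      exact oddSector_virialTerm_nonpos z h01 hβpos hodd
  -- summing the majorant
  have hsum1 : ∑ z : Fin 3 → Bool, (if z 0 = z 1 ∧ z 2 = false then (1 / 2 - c₁) * Z z else 0) ≤ (1 / 2 - c₁) * ∑ z : Fin 3 → Bool, Z z := by
    rw [Finset.mul_sum]
    refine Finset.sum_le_sum fun z _ => ?_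
    split_ifs
    · exact le_rfl
    · exact mul_nonneg (by linarith) (hZ0 z)
  have hsum2 : ∑ z : Fin 3 → Bool, (if z 0 = z 1 ∧ z 2 = true then 9 * (L : ℝ) ^ 4 * Z (fun k => decide (k = 2)) else 0) ≤
      8 * (9 * (L : ℝ) ^ 4 * Z (fun k => decide (k = 2))) := by
    have hA : 0 ≤ 9 * (L : ℝ) ^ 4 * Z (fun k => decide (k = 2)) := by have := hZ0 (fun k => decide (k = 2)); positivity
    calc ∑ z : Fin 3 → Bool, (if z 0 = z 1 ∧ z 2 = true then 9 * (L : ℝ) ^ 4 * Z (fun k => decide (k = 2)) else 0)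
        ≤ ∑ _z : Fin 3 → Bool, 9 * (L : ℝ) ^ 4 * Z (fun k => decide (k = 2)) := Finset.sum_le_sum fun z _ => by split_ifs <;> linarith
      _ = 8 * (9 * (L : ℝ) ^ 4 * Z (fun k => decide (k = 2))) := by
          rw [Finset.sum_const, Finset.card_univ, FemtoTransferGap.TT.card_twists, nsmul_eq_mul]; norm_num
  have hsingle : Z (fun _ => false) ≤ ∑ z : Fin 3 → Bool, Z z :=
    Finset.single_le_sum (fun z _ => hZ0 z) (Finset.mem_univ (fun _ : Fin 3 => false))
  have hmain : ∑ z : Fin 3 → Bool, T z ≤ (1 / 2 - c₁ / 2) * ∑ z : Fin 3 → Bool, Z z := by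
    calc ∑ z : Fin 3 → Bool, T z ≤ ∑ z : Fin 3 → Bool, g z := Finset.sum_le_sum fun z _ => claim z
      _ = (∑ z : Fin 3 → Bool, (if z 0 = z 1 ∧ z 2 = false then (1 / 2 - c₁) * Z z else 0))
            + ∑ z : Fin 3 → Bool, (if z 0 = z 1 ∧ z 2 = true then 9 * (L : ℝ) ^ 4 * Z (fun k => decide (k = 2)) else 0) := Finset.sum_add_distrib
      _ ≤ (1 / 2 - c₁) * (∑ z : Fin 3 → Bool, Z z) + 8 * (9 * (L : ℝ) ^ 4 * Z (fun k => decide (k = 2))) := add_le_add hsum1 hsum2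
      _ ≤ (1 / 2 - c₁) * (∑ z : Fin 3 → Bool, Z z) + c₁ / 2 * ∑ z : Fin 3 → Bool, Z z := by nlinarith
      _ = (1 / 2 - c₁ / 2) * ∑ z : Fin 3 → Bool, Z z := by ring
  -- fold back
  have hfold : K * ∑ z : Fin 3 → Bool,
      (1 / 2 * (∫ a, (∑ ε : GnoSign L, ∫ η : GnoCoord L,
          gnoW η * Real.exp (-(β * gnoDeficit z (fun _ => 1) a ε η)) * gnoDensity η) ∂coneMeasure)
        - β * (∫ a, (∑ ε : GnoSign L, ∫ η : GnoCoord L,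
          (gnoDeficit z (fun _ => 1) a ε η - gnoXDeficit z (fun _ => 1) a ε η / 2) *
            Real.exp (-(β * gnoDeficit z (fun _ => 1) a ε η)) * gnoDensity η) ∂coneMeasure)) = ∑ z : Fin 3 → Bool, T z := by
    rw [Finset.mul_sum]
  rw [hfold]
  exact hmain

/-- ★★★ **⟨24197⟩ BY NAME FROM (P-VW) + (M)**: the principal-sector virial window and the minus-class relative smallness imply
`Theses.SwapVirialDeficit.SwapGluedStiffness` (✓`virialWindow_of_principal_and_minus` + ✓`swapGluedStiffness_of_virialWindow`).  CONDITIONAL: (P-VW) and (M)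
are OPEN. [cite: tHooft1979] [cite: Luscher1983, §2] -/
theorem swapGluedStiffness_of_principalVirialWindow_and_minus
    (hP : ∃ a : ℝ, 0 < a ∧ ∃ c : ℝ, 0 < c ∧ ∃ β₀ : ℝ, ∃ L₀ : ℕ, ∀ β : ℝ, β₀ ≤ β → ∀ (L : ℕ) [NeZero L], L₀ ≤ L → (L : ℝ) ≤ β ^ a →
      (coneConst ^ 3 / 64 * (1 / (2 * Real.pi ^ 2)) ^ Fintype.card (Fol L)) *
          (1 / 2 * (∫ a, (∑ ε : GnoSign L, ∫ η : GnoCoord L,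
              gnoW η * Real.exp (-(β * gnoDeficit (fun _ => false) (fun _ => 1) a ε η)) * gnoDensity η) ∂coneMeasure)
            - β * (∫ a, (∑ ε : GnoSign L, ∫ η : GnoCoord L,
              (gnoDeficit (fun _ => false) (fun _ => 1) a ε η - gnoXDeficit (fun _ => false) (fun _ => 1) a ε η / 2) *
                Real.exp (-(β * gnoDeficit (fun _ => false) (fun _ => 1) a ε η)) * gnoDensity η) ∂coneMeasure)) ≤
        (1 / 2 - c) * ∫ p, Real.exp (-(β * swapRingDeficit L (fun _ => false) p)) ∂(ringMeasure L))
    (hM : ∀ ε : ℝ, 0 < ε → ∃ a : ℝ, 0 < a ∧ ∃ β₀ : ℝ, ∃ L₀ : ℕ, ∀ β : ℝ, β₀ ≤ β → ∀ (L : ℕ) [NeZero L], L₀ ≤ L → (L : ℝ) ≤ β ^ a →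
      (L : ℝ) ^ 4 * ∫ p, Real.exp (-(β * swapRingDeficit L (fun k => decide (k = 2)) p)) ∂(ringMeasure L) ≤
        ε * ∫ p, Real.exp (-(β * swapRingDeficit L (fun _ => false) p)) ∂(ringMeasure L)) :
    Summit.QuantumFields.YangMills.Theses.SwapVirialDeficit.SwapGluedStiffness :=
  swapGluedStiffness_of_virialWindow (virialWindow_of_principal_and_minus hP hM)

end Summit.QuantumFields.YangMills.Theorems.SwapVirialDeficit.BlowUpRing


end
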